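import Literature.AnabelianGeometry.SemiGraphs.TreeSystemBoundedGeodesics
import Mathlib.Data.Fintype.Order
import HarnessLib

/-!
# Fixed crossings in an inverse system of trees ([SemiAnbd] Thm. 3.7 (iii), p. 41)

Mochizuki, *Semi-graphs of anabelioids*, Publ. RIMS **42** (2006), Thm. 3.7 (iii) and its proof, p. 41,
with the author's *Comments* (2020) (6). [cite: MochizukiSemiAnbd2006, Thm. 3.7(iii) p.41]

PROOF-ONLY tool file (cell abc-iut, layer L3; GAP row G-t6g3-2b, sub-row G2·E2-unbounded «vertical
branch», rulings α33/α47; seat abc-iut-w5-d160; no definition; nothing specific to anabelioids).  For a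
subgroup `C` of a group `P` acting on a system of TREES `T j` with transition morphisms
`f : T j ⟶ T i` and two compatible systems `x`, `x'` of `C`-fixed vertices (currency of
`TreeSystemBoundedGeodesics.lean`):

* `SemiGraph.not_joins_of_vertexMap_eq` — NO RE-ADJACENCY: two vertices with the same image under a
  morphism to a tree are not joined by an edge (the edge would map to an edge with two distinct branches
  at one vertex); so compatible vertex systems that agree at one level are, above it, equal or at least
  two edges apart — never adjacent;
* `SemiGraph.exists_fixedSubjoint_lastDeparture` — the CROSSING LEMMA: if at level `i` the geodesic from
  `x i` to `x' i` has an interior vertex `u` (node `4`) with geodesic branch `β₁` (node `3`) on the `x`-side,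
  then at EVERY level `K ≥ i` there is a `C`-fixed subjoint `(y; δ₁ ≠ δ)` of `T K` over `u` whose first
  branch lies over `β₁` and whose second branch lies over a branch of `u` DIFFERENT from `β₁`: the image of
  the level-`K` geodesic is a walk covering the level-`i` geodesic, and at its LAST DEPARTURE from the
  branch-point `β₁` it must step `β₁ → u → β` with `β ≠ β₁` (the suffix avoids `β₁`, while every walk from
  the edge-point of `β₁` to `x' i` passes `β₁` — `Walk.bypass` + `IsAcyclic.path_unique`); the three
  consecutive nodes of the level-`K` geodesic over `β₁, u, β` are the subjoint, fixed by Lem. 1.8 (ii)(b);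
* `SemiGraph.exists_cofinal_fibre_of_finite` — PIGEONHOLE on a directed index set: a function from the
  levels `≥ i` to a finite type takes one value on a COFINAL set of levels.

With finite stars at `u` these feed a König selection of a COMPATIBLE `C`-fixed subjoint system over a
fixed base subjoint `(u; β₁, β)` (the cell's subjoint-selection file, abc-iut-w5-d189), which total
estrangement kills — whence the second clause `hadj` of the input (FIX∞) without any boundedness, modulo
finiteness of the `C`-fixed fibres over `u` (the «vertical finiteness» residual of G-t6g3-2b).  Test case
`𝒢⋆` (abc-iut-w4-d075): one compatible fixed system only — hypotheses never met; finite 𝔾: agrees with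
the (∗_j) route.
-/

namespace Literature.AnabelianGeometry.SemiGraphs

namespace SemiGraph

open CategoryTheory

universe v u

/-! ### No re-adjacency -/

/-- **No re-adjacency.**  Two vertices of `G` with the SAME image under a morphism `φ : G ⟶ G'` to a
tree are not joined by an edge of `G`: the image edge would have two distinct branches (morphisms are
injective on the branches of an edge) at one vertex of the tree `G'`.  Hence compatible vertex systems of
an inverse system of trees that agree at some level are never adjacent at a higher level.
[cite: MochizukiSemiAnbd2006, Thm. 3.7(iii) p.41] -/
theorem not_joins_of_vertexMap_eq {G G' : SemiGraph.{u}} (hG' : G'.IsTree) (φ : G ⟶ G')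
    {y y' : G.Vertex} (h : φ.vertexMap y = φ.vertexMap y') {e : G.Edge} (hj : G.Joins e y y') :
    False := by
  obtain ⟨b, b', hne, hbe, hb'e, hby, hb'y⟩ := hj
  have hA : G'.subdivision.IsAcyclic := hG'.isTree.isAcyclic
  have heq : φ.branchMap b = φ.branchMap b' :=
    branch_unique_of_isAcyclic hA (by rw [φ.edgeOf_branchMap, φ.edgeOf_branchMap, hbe, hb'e])
      (φ.abuts_branchMap b y hby) (by rw [φ.abuts_branchMap b' y' hb'y, h])
  exact hne (φ.branchMap_injOn b b' (hbe.trans hb'e.symm) heq)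

/-! ### Pigeonhole on a directed set of levels -/

/-- **Pigeonhole over a directed index set**: a function from the levels `≥ i` of a directed preorder to
a FINITE type takes some value on a COFINAL set of levels (the "by possibly replacing `J` by some smaller
cofinal subset" step of the proof of [SemiAnbd] Thm. 3.7 (iii), p. 41 / Comments (6), in the form used to
fix the exit branch of the crossings). [cite: MochizukiSemiAnbd2006, Thm. 3.7(iii) p.41] -/
theorem exists_cofinal_fibre_of_finite {J : Type v} [Preorder J] [IsDirectedOrder J] {α : Type*}
    [Finite α] (i : J) (g : {K : J // i ≤ K} → α) :
    ∃ a : α, ∀ (K : J) (hK : i ≤ K), ∃ (K' : J) (h : K ≤ K'), g ⟨K', hK.trans h⟩ = a := by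
  classical
  by_contra hno
  push Not at hno
  -- for each value `a`, a level `K a ≥ i` above which `a` is never taken
  choose K hK hnot using hno
  haveI : Nonempty J := ⟨i⟩
  -- a common upper bound of the finitely many `K a`
  obtain ⟨M, hM⟩ := (Set.finite_range K).exists_le
  have hKM : ∀ a, K a ≤ M := fun a => hM (K a) ⟨a, rfl⟩
  have a₀ : α := g ⟨i, le_refl i⟩
  have hiM : i ≤ M := (hK a₀).trans (hKM a₀)
  exact hnot (g ⟨M, hiM⟩) M (hKM _) rfl

/-! ### The crossing lemma -/

section System

variable {P : Type u} [Group P] {J : Type v} [Preorder J]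

/-- **Crossing lemma (last departure).**  Let `x`, `x'` be compatible systems of `C`-fixed vertices of the
system of trees `(T, f, ρ)`, and let the level-`i` geodesic `p` from `x i` to `x' i` have an interior vertex
`u` at node `4`, reached through the branch `β₁` at node `3` (of the edge at node `2`).  Then for every
level `K ≥ i` there is a `C`-fixed subjoint `(y; δ₁, δ)` of `T K` — two distinct branches `δ₁ ≠ δ` abutting
to `y`, all three fixed by `C` — with `f y = u`, `f δ₁ = β₁`, and `f δ` a branch at `u` different from `β₁`.
(The image of the level-`K` geodesic covers `p`; at its last departure from the branch-point `β₁` it steps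
`β₁ → u → β`, `β ≠ β₁`; lift the three nodes.) [cite: MochizukiSemiAnbd2006, Thm. 3.7(iii) p.41] -/
theorem exists_fixedSubjoint_lastDeparture (C : Subgroup P) (T : J → SemiGraph.{u})
    (hT : ∀ j, (T j).IsTree) (ρ : ∀ j, P →* Aut (T j)) (f : ∀ ⦃i j : J⦄, i ≤ j → (T j ⟶ T i))
    (x x' : ∀ j, (T j).Vertex)
    (hx : ∀ ⦃i j : J⦄ (h : i ≤ j), (f h).vertexMap (x j) = x i)
    (hx' : ∀ ⦃i j : J⦄ (h : i ≤ j), (f h).vertexMap (x' j) = x' i)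
    (hfx : ∀ (j : J) (γ : C), (ρ j γ).hom.vertexMap (x j) = x j)
    (hfx' : ∀ (j : J) (γ : C), (ρ j γ).hom.vertexMap (x' j) = x' j)
    {i : J} (p : (T i).subdivision.Walk (Sum.inl (x i)) (Sum.inl (x' i))) (hp : p.IsPath)
    (h4 : 4 < p.length) {e₁ : (T i).Edge} {β₁ : (T i).Branch} {u : (T i).Vertex}
    (h2 : p.getVert 2 = Sum.inr (Sum.inl e₁)) (h3 : p.getVert 3 = Sum.inr (Sum.inr β₁))
    (h4u : p.getVert 4 = Sum.inl u) (hβ₁e : (T i).edgeOf β₁ = e₁) (hβ₁u : (T i).abuts β₁ = some u)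
    {K : J} (h : i ≤ K) :
    ∃ (y : (T K).Vertex) (δ₁ δ : (T K).Branch), δ₁ ≠ δ ∧ (T K).abuts δ₁ = some y ∧
      (T K).abuts δ = some y ∧ (f h).vertexMap y = u ∧ (f h).branchMap δ₁ = β₁ ∧
      (f h).branchMap δ ≠ β₁ ∧ (T i).abuts ((f h).branchMap δ) = some u ∧
      ∀ γ : C, (ρ K γ).hom.vertexMap y = y ∧ (ρ K γ).hom.branchMap δ₁ = δ₁ ∧
        (ρ K γ).hom.branchMap δ = δ := by
  classical
  have hA : (T i).subdivision.IsAcyclic := (hT i).isTree.isAcyclic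
  -- the level-`K` geodesic `q` and its image walk `W` at level `i`
  obtain ⟨q, hq⟩ := (hT K).isTree.connected.exists_walk_length_eq_dist (Sum.inl (x K)) (Sum.inl (x' K))
  have hqpath : q.IsPath := q.isPath_of_length_eq_dist hq
  let Φ : (T K).subdivision →g (T i).subdivision :=
    ⟨Sum.map (f h).vertexMap (Sum.map (f h).edgeMap (f h).branchMap),
      fun hab => subdivision_adj_map (f h) hab⟩
  have hΦv : ∀ w : (T K).Vertex, Φ (Sum.inl w) = Sum.inl ((f h).vertexMap w) := fun _ => rfl
  have hΦe : ∀ e : (T K).Edge, Φ (Sum.inr (Sum.inl e)) = Sum.inr (Sum.inl ((f h).edgeMap e)) :=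
    fun _ => rfl
  have hΦb : ∀ b : (T K).Branch, Φ (Sum.inr (Sum.inr b)) = Sum.inr (Sum.inr ((f h).branchMap b)) :=
    fun _ => rfl
  have ex : Φ (Sum.inl (x K)) = Sum.inl (x i) := by rw [hΦv, hx h]
  have ex' : Φ (Sum.inl (x' K)) = Sum.inl (x' i) := by rw [hΦv, hx' h]
  let W : (T i).subdivision.Walk (Sum.inl (x i)) (Sum.inl (x' i)) := (q.map Φ).copy ex ex'
  have hWq : ∀ t, W.getVert t = Φ (q.getVert t) := fun t => by
    simp only [W, SimpleGraph.Walk.getVert_copy, SimpleGraph.Walk.getVert_map]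
  have hWlen : W.length = q.length := by
    simp only [W, SimpleGraph.Walk.length_copy, SimpleGraph.Walk.length_map]
  -- `W` covers `p`: in particular it visits the branch-point `β₁`
  have hcover : p.support ⊆ W.support := by
    have hb : W.bypass = p := congrArg Subtype.val (hA.path_unique ⟨W.bypass, W.bypass_isPath⟩ ⟨p, hp⟩)
    rw [← hb]
    exact W.support_bypass_subset_support
  have hβ₁W : (Sum.inr (Sum.inr β₁) : (T i).Node) ∈ W.support := by
    apply hcover
    rw [← h3]
    exact p.getVert_mem_support 3
  -- the LAST visit `t₀` of `W` to `β₁`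
  obtain ⟨m₀, hm₀, hm₀le⟩ := SimpleGraph.Walk.mem_support_iff_exists_getVert.mp hβ₁W
  set t₀ := Nat.findGreatest (fun t => W.getVert t = Sum.inr (Sum.inr β₁)) W.length with ht₀def
  have ht₀ : W.getVert t₀ = Sum.inr (Sum.inr β₁) :=
    Nat.findGreatest_spec (P := fun t => W.getVert t = Sum.inr (Sum.inr β₁)) hm₀le hm₀
  have ht₀le : t₀ ≤ W.length := Nat.findGreatest_le _
  have hmax : ∀ t, t₀ < t → t ≤ W.length → W.getVert t ≠ Sum.inr (Sum.inr β₁) := fun t ht htl =>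
    Nat.findGreatest_is_greatest (P := fun t => W.getVert t = Sum.inr (Sum.inr β₁)) ht htl
  have ht₀lt : t₀ < W.length := by
    rcases Nat.lt_or_ge t₀ W.length with hlt | hge
    · exact hlt
    · exfalso
      have : W.getVert t₀ = Sum.inl (x' i) := by
        rw [le_antisymm ht₀le hge]; exact W.getVert_length
      rw [ht₀] at this
      exact Sum.inr_ne_inl this
  -- the next node is the vertex-point `u` (not the edge-point `e₁`: the suffix would have to return through `β₁`)
  have hstep : W.getVert (t₀ + 1) = Sum.inl u := by
    have hadj := W.adj_getVert_succ ht₀lt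
    rw [ht₀, subdivision_adj_branch_iff] at hadj
    rcases hadj with hE | ⟨w, hw, hE⟩
    · exfalso
      -- the suffix `W'` from the edge-point `e₁` to `x' i` avoids `β₁`, but every such walk passes `β₁`
      rw [hβ₁e] at hE
      let W' : (T i).subdivision.Walk (Sum.inr (Sum.inl e₁)) (Sum.inl (x' i)) :=
        (W.drop (t₀ + 1)).copy hE rfl
      let p₂ : (T i).subdivision.Walk (Sum.inr (Sum.inl e₁)) (Sum.inl (x' i)) := (p.drop 2).copy h2 rfl
      have hp₂ : p₂.IsPath := by
        simpa only [p₂, SimpleGraph.Walk.isPath_copy] using hp.drop 2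
      have hb : W'.bypass = p₂ :=
        congrArg Subtype.val (hA.path_unique ⟨W'.bypass, W'.bypass_isPath⟩ ⟨p₂, hp₂⟩)
      have hβ₁p₂ : (Sum.inr (Sum.inr β₁) : (T i).Node) ∈ p₂.support := by
        have : p₂.getVert 1 = Sum.inr (Sum.inr β₁) := by
          simp only [p₂, SimpleGraph.Walk.getVert_copy, SimpleGraph.Walk.drop_getVert]
          exact h3
        rw [← this]
        exact p₂.getVert_mem_support 1
      have hβ₁W' : (Sum.inr (Sum.inr β₁) : (T i).Node) ∈ W'.support := by
        rw [← hb] at hβ₁p₂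
        exact W'.support_bypass_subset_support hβ₁p₂
      obtain ⟨m, hm, hmle⟩ := SimpleGraph.Walk.mem_support_iff_exists_getVert.mp hβ₁W'
      have hm' : W.getVert (t₀ + 1 + m) = Sum.inr (Sum.inr β₁) := by
        simpa only [W', SimpleGraph.Walk.getVert_copy, SimpleGraph.Walk.drop_getVert] using hm
      have hlen' : W'.length = W.length - (t₀ + 1) := by
        simp only [W', SimpleGraph.Walk.length_copy, SimpleGraph.Walk.drop_length]
      exact hmax (t₀ + 1 + m) (by omega) (by omega) hm'
    · have hwu : w = u := by rw [hβ₁u] at hw; exact (Option.some_injective _ hw).symm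
      rw [hE, hwu]
  -- `u ≠ x' i`, so the walk goes on: the node after `u` is a branch `β ≠ β₁` at `u`
  have ht₁lt : t₀ + 1 < W.length := by
    rcases Nat.lt_or_ge (t₀ + 1) W.length with hlt | hge
    · exact hlt
    · exfalso
      have heq : W.getVert (t₀ + 1) = Sum.inl (x' i) := by
        rw [le_antisymm (by omega) hge]; exact W.getVert_length
      rw [hstep] at heq
      have hux : p.getVert 4 = p.getVert p.length := by rw [h4u, heq, p.getVert_length]
      have := hp.getVert_injOn (by simp; omega) (by simp) hux
      omega
  obtain ⟨β, hβu, hstep2⟩ : ∃ β : (T i).Branch, (T i).abuts β = some u ∧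
      W.getVert (t₀ + 2) = Sum.inr (Sum.inr β) := by
    have hadj := W.adj_getVert_succ ht₁lt
    rw [hstep, subdivision_adj_inl_iff] at hadj
    exact hadj
  have hββ₁ : β ≠ β₁ := by
    intro hb
    exact hmax (t₀ + 2) (by omega) (by omega) (by rw [hstep2, hb])
  -- lift the three nodes along `q`
  obtain ⟨δ₁, hqt₀, hδ₁⟩ : ∃ δ₁ : (T K).Branch, q.getVert t₀ = Sum.inr (Sum.inr δ₁) ∧
      (f h).branchMap δ₁ = β₁ := by
    have e := hWq t₀
    rw [ht₀] at e
    rcases hq0 : q.getVert t₀ with w | e' | b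
    · rw [hq0, hΦv] at e; exact absurd e.symm Sum.inl_ne_inr
    · rw [hq0, hΦe] at e; simp at e
    · rw [hq0, hΦb] at e
      exact ⟨b, rfl, (Sum.inr_injective (Sum.inr_injective e)).symm⟩
  obtain ⟨y, hqt₁, hy⟩ : ∃ y : (T K).Vertex, q.getVert (t₀ + 1) = Sum.inl y ∧ (f h).vertexMap y = u := by
    have e := hWq (t₀ + 1)
    rw [hstep] at e
    rcases hq1 : q.getVert (t₀ + 1) with w | e' | b
    · rw [hq1, hΦv] at e; exact ⟨w, rfl, (Sum.inl_injective e).symm⟩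
    · rw [hq1, hΦe] at e; exact absurd e Sum.inl_ne_inr
    · rw [hq1, hΦb] at e; exact absurd e Sum.inl_ne_inr
  obtain ⟨δ, hqt₂, hδ⟩ : ∃ δ : (T K).Branch, q.getVert (t₀ + 2) = Sum.inr (Sum.inr δ) ∧
      (f h).branchMap δ = β := by
    have e := hWq (t₀ + 2)
    rw [hstep2] at e
    rcases hq2 : q.getVert (t₀ + 2) with w | e' | b
    · rw [hq2, hΦv] at e; exact absurd e.symm Sum.inl_ne_inr
    · rw [hq2, hΦe] at e; simp at e
    · rw [hq2, hΦb] at e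
      exact ⟨b, rfl, (Sum.inr_injective (Sum.inr_injective e)).symm⟩
  -- adjacency along `q` gives the abutments
  have hq₀lt : t₀ < q.length := by rw [← hWlen]; exact ht₀lt
  have hq₁lt : t₀ + 1 < q.length := by rw [← hWlen]; exact ht₁lt
  have hδ₁y : (T K).abuts δ₁ = some y := by
    have hadj := q.adj_getVert_succ hq₀lt
    rw [hqt₀, hqt₁, subdivision_adj_branch_iff] at hadj
    rcases hadj with hE | ⟨w, hw, hE⟩
    · exact absurd hE Sum.inl_ne_inr
    · rw [hw, Sum.inl_injective hE]
  have hδy : (T K).abuts δ = some y := by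
    have hadj := q.adj_getVert_succ hq₁lt
    rw [hqt₁, subdivision_adj_inl_iff] at hadj
    obtain ⟨b, hb, hE⟩ := hadj
    rw [hqt₂] at hE
    rw [Sum.inr_injective (Sum.inr_injective hE)]
    exact hb
  have hne : δ₁ ≠ δ := by
    intro hd
    apply hββ₁
    rw [← hδ, ← hd, hδ₁]
  -- `C` fixes the geodesic `q` pointwise
  have hAK : (T K).subdivision.IsAcyclic := (hT K).isTree.isAcyclic
  refine ⟨y, δ₁, δ, hne, hδ₁y, hδy, hy, hδ₁, by rw [hδ]; exact hββ₁, by rw [hδ]; exact hβu,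
    fun γ => ?_⟩
  have hfix : ∀ z ∈ q.support, nodeMap (ρ K γ) z = z :=
    nodeMap_eq_self_of_isPath hAK (ρ K γ) (x := Sum.inl (x K)) (y := Sum.inl (x' K))
      (by simp only [nodeMap, Sum.map_inl, hfx]) (by simp only [nodeMap, Sum.map_inl, hfx']) q hqpath
  have f0 := hfix _ (q.getVert_mem_support t₀)
  have f1 := hfix _ (q.getVert_mem_support (t₀ + 1))
  have f2 := hfix _ (q.getVert_mem_support (t₀ + 2))
  rw [hqt₀] at f0
  rw [hqt₁] at f1
  rw [hqt₂] at f2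
  exact ⟨Sum.inl_injective f1, Sum.inr_injective (Sum.inr_injective f0),
    Sum.inr_injective (Sum.inr_injective f2)⟩

end System

end SemiGraph

end Literature.AnabelianGeometry.SemiGraphs
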